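import Literature.NumberTheory.QuadraticFields.ReducedFormOfSplitNumber
import Mathlib.Data.Nat.Factorization.Basic
import HarnessLib

/-!
# Square roots modulo powers of `2`, and `b² ≡ Δ (mod 4a)` for arbitrary `a`

Sequel of `SquareRootsModulo.lean` (odd moduli). The prime `2` belongs to Lenstra–Pomerance's set
`𝒫_Δ = {p : (Δ/p) = 1}` iff `Δ ≡ 1 (mod 8)` (J. Amer. Math. Soc. **5** (1992), (2.7)), and then
`Δ` is a square modulo every power of `2`:

* `exists_sq_sub_dvd_two_pow` — **Hensel at `2`**: if `Δ ≡ 1 (mod 8)` then for every `k ≥ 3`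
  there is `y` with `2^k ∣ y² − Δ` (step `y ↦ y + 2^{k−1}` when `(y² − Δ)/2^k` is odd);
* `isSquare_zmod_two_pow` — the same in `ZMod (2^k)`, all `k`;
* `exists_sq_sub_dvd_four_mul'` — for `Δ ≡ 0, 1 (mod 4)` and any `a ≥ 1` such that
  `Δ ≡ 1 (mod 8)` if `a` is even and every odd prime `p ∣ a` has `p ∤ Δ`, `Δ` a square mod `p`:
  `b² ≡ Δ (mod 4a)` is solvable (write `4a = 2^{e+2} a'`, combine by the Chinese remainder
  theorem). This removes the restriction "`a` odd" from `exists_sq_sub_dvd_four_mul`, as needed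
  for Lemma 2.10 of the paper in full:
* `BinaryQuadraticForm.exists_mem_reducedForms_of_split'` — **Lemma 2.10** for arbitrary `a ≥ 1`
  (`4a² ≤ −Δ`, all prime factors of `a` in `𝒫_Δ`): some `(a, b, c)` lies in `reducedForms Δ`.

Everything is proved.

## References

* H. W. Lenstra Jr., C. Pomerance, J. Amer. Math. Soc. 5 (1992) 483–516, §2 (2.6)–(2.7) and
  Lemma 2.10. [LenstraPomerance1992]
* I. Niven, H. S. Zuckerman, H. L. Montgomery, *An Introduction to the Theory of Numbers*, 5th ed.,
  §2.6 and Thm 2.24 (squares modulo `2^k`).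
-/

namespace Literature.NumberTheory.QuadraticFields

/-! ### Hensel's lemma at the prime `2` -/

/-- **Squares modulo `2^k`.** If `Δ ≡ 1 (mod 8)` then for every `k ≥ 3` there is `y` with
`2^k ∣ y² − Δ`. [folklore] -/
theorem exists_sq_sub_dvd_two_pow {Δ : ℤ} (hΔ : Δ % 8 = 1) {k : ℕ} (hk : 3 ≤ k) :
    ∃ y : ℤ, (2 : ℤ) ^ k ∣ y ^ 2 - Δ := by
  induction k, hk using Nat.le_induction with
  | base => exact ⟨1, by norm_num; omega⟩
  | succ k hk ih =>
    obtain ⟨y, m, hm⟩ := ih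
    -- `y` is odd since `Δ` is odd and `k ≥ 1`
    have hy : Odd y := by
      by_contra he
      rw [Int.not_odd_iff_even] at he
      obtain ⟨r, hr⟩ := he
      have h2 : (2 : ℤ) ∣ y ^ 2 - Δ := (dvd_pow_self 2 (by omega)).trans ⟨m, hm⟩
      have hy2 : (2 : ℤ) ∣ y ^ 2 := ⟨2 * r * r, by rw [hr]; ring⟩
      have hΔ2 : (2 : ℤ) ∣ Δ := by
        have := dvd_sub hy2 h2
        simpa using this
      omega
    rcases Int.even_or_odd m with ⟨r, hr⟩ | ⟨r, hr⟩
    · -- `m` even: `y` already works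
      refine ⟨y, r, ?_⟩
      rw [hm, hr, pow_succ]
      ring
    · -- `m` odd: take `y + 2^(k-1)`
      obtain ⟨s, hs⟩ := hy
      obtain ⟨j, rfl⟩ : ∃ j, k = j + 3 := ⟨k - 3, by omega⟩
      refine ⟨y + 2 ^ (j + 2), ?_⟩
      have e : (y + 2 ^ (j + 2)) ^ 2 - Δ =
          (2 : ℤ) ^ (j + 3 + 1) * (r + s + 1 + 2 ^ j) := by
        have h1 : y ^ 2 - Δ = 2 ^ (j + 3) * (2 * r + 1) := by rw [hm, hr]
        have h2 : y = 2 * s + 1 := hs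
        have : (y + 2 ^ (j + 2)) ^ 2 - Δ = (y ^ 2 - Δ) + 2 ^ (j + 3) * y + 2 ^ (2 * j + 4) := by
          ring
        rw [this, h1, h2]
        ring
      rw [e]
      exact Dvd.intro _ rfl

/-- In `ZMod` language: `Δ ≡ 1 (mod 8)` is a square modulo every power of `2`. [folklore] -/
theorem isSquare_zmod_two_pow {Δ : ℤ} (hΔ : Δ % 8 = 1) (k : ℕ) : IsSquare (Δ : ZMod (2 ^ k)) := by
  rcases le_or_gt 3 k with hk | hk
  · obtain ⟨y, hy⟩ := exists_sq_sub_dvd_two_pow hΔ hk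
    exact (isSquare_intCast_zmod_iff Δ (2 ^ k)).2 ⟨y, by exact_mod_cast hy⟩
  · -- `k ≤ 2`: `Δ ≡ 1 (mod 4)`, and `1` is a square
    refine (isSquare_intCast_zmod_iff Δ (2 ^ k)).2 ⟨1, ?_⟩
    have h4 : (4 : ℤ) ∣ 1 ^ 2 - Δ := by omega
    refine (dvd_trans ?_ h4)
    have h' : 2 ^ k ∣ 2 ^ 2 := Nat.pow_dvd_pow 2 (by omega)
    have h'' : ((2 ^ k : ℕ) : ℤ) ∣ ((2 ^ 2 : ℕ) : ℤ) := Int.natCast_dvd_natCast.2 h'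
    simpa using h''

/-! ### `b² ≡ Δ (mod 4a)` for arbitrary `a` -/

/-- A discriminant is a square modulo `4`. [folklore] -/
theorem isSquare_zmod_four_of_discr {Δ : ℤ} (hΔ : Δ % 4 = 0 ∨ Δ % 4 = 1) :
    IsSquare (Δ : ZMod 4) := by
  rcases hΔ with h | h
  · exact (isSquare_intCast_zmod_iff Δ 4).2 ⟨0, by push_cast; omega⟩
  · exact (isSquare_intCast_zmod_iff Δ 4).2 ⟨1, by push_cast; omega⟩

/-- **`b² ≡ Δ (mod 4a)` is solvable** for `Δ ≡ 0, 1 (mod 4)` and `a ≥ 1` whenever `Δ ≡ 1 (mod 8)`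
in case `a` is even, and every odd prime `p ∣ a` satisfies `p ∤ Δ` with `Δ` a square modulo `p`
(all prime factors of `a` in `𝒫_Δ`). The first step of [LP92, Lemma 2.10], without parity
restriction on `a`. [cite: LenstraPomerance1992, §2 Lemma 2.10 (proof)] -/
theorem exists_sq_sub_dvd_four_mul' {Δ : ℤ} (hΔ : Δ % 4 = 0 ∨ Δ % 4 = 1) {a : ℕ} (ha : 0 < a)
    (h2 : 2 ∣ a → Δ % 8 = 1)
    (hsplit : ∀ p ∈ a.primeFactors, p ≠ 2 → ¬ (p : ℤ) ∣ Δ ∧ IsSquare (Δ : ZMod p)) :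
    ∃ b : ℤ, (4 * a : ℤ) ∣ b ^ 2 - Δ := by
  obtain ⟨e, a', ha', hea⟩ := Nat.exists_eq_two_pow_mul_odd ha.ne'
  have ha'0 : a' ≠ 0 := by rintro rfl; simp at ha'
  -- odd part
  have hodd : IsSquare (Δ : ZMod a') := by
    refine isSquare_zmod_of_forall_primeFactors ha' (fun p hp => ?_) fun p hp => ?_
    · have hp' : p ∈ a.primeFactors := by
        rw [hea, Nat.primeFactors_mul (pow_ne_zero e two_ne_zero) ha'0]
        exact Finset.mem_union_right _ hp
      have hp2 : p ≠ 2 := by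
        rintro rfl
        have : 2 ∣ a' := Nat.dvd_of_mem_primeFactors hp
        exact (Nat.not_even_iff_odd.2 ha') (even_iff_two_dvd.2 this)
      exact (hsplit p hp' hp2).1
    · have hp' : p ∈ a.primeFactors := by
        rw [hea, Nat.primeFactors_mul (pow_ne_zero e two_ne_zero) ha'0]
        exact Finset.mem_union_right _ hp
      have hp2 : p ≠ 2 := by
        rintro rfl
        have : 2 ∣ a' := Nat.dvd_of_mem_primeFactors hp
        exact (Nat.not_even_iff_odd.2 ha') (even_iff_two_dvd.2 this)
      exact (hsplit p hp' hp2).2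
  -- the power of two: modulus `2^(e+2)`
  have htwo : IsSquare (Δ : ZMod (2 ^ (e + 2))) := by
    rcases Nat.eq_zero_or_pos e with rfl | he
    · simpa using isSquare_zmod_four_of_discr hΔ
    · have h8 : Δ % 8 = 1 := h2 (by rw [hea]; exact (dvd_pow_self 2 he.ne').mul_right _)
      exact isSquare_zmod_two_pow h8 (e + 2)
  -- combine
  have hcop : Nat.Coprime (2 ^ (e + 2)) a' := (Nat.coprime_two_left.2 ha').pow_left _
  have hsq := isSquare_zmod_mul_of_coprime hcop htwo hodd
  obtain ⟨b, hb⟩ := (isSquare_intCast_zmod_iff Δ (2 ^ (e + 2) * a')).1 hsq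
  refine ⟨b, ?_⟩
  have e4 : (4 * a : ℤ) = ((2 ^ (e + 2) * a' : ℕ) : ℤ) := by rw [hea]; push_cast; ring
  rw [e4]
  exact hb

/-! ### Lemma 2.10 without parity restriction -/

/-- **Lenstra–Pomerance, Lemma 2.10.** Let `Δ < 0`, `Δ ≡ 0` or `1 (mod 4)`, and `a ≥ 1` with
`4a² ≤ −Δ` all of whose prime factors lie in `𝒫_Δ`: `Δ ≡ 1 (mod 8)` if `2 ∣ a`, and every odd
prime `p ∣ a` has `p ∤ Δ` and `Δ` a square modulo `p`. Then there are `b, c ∈ ℤ` with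
`(a, b, c) ∈ reducedForms Δ` (a reduced primitive positive definite form of discriminant `Δ` with
first coefficient `a`). The odd case is `BinaryQuadraticForm.exists_mem_reducedForms_of_split`.
[cite: LenstraPomerance1992, §2 Lemma 2.10] -/
theorem BinaryQuadraticForm.exists_mem_reducedForms_of_split' {Δ : ℤ} (hΔ : Δ < 0)
    (hΔ4 : Δ % 4 = 0 ∨ Δ % 4 = 1) {a : ℕ} (ha : 0 < a) (hsize : 4 * (a : ℤ) ^ 2 ≤ -Δ)
    (h2 : 2 ∣ a → Δ % 8 = 1)
    (hsplit : ∀ p ∈ a.primeFactors, p ≠ 2 → ¬ (p : ℤ) ∣ Δ ∧ IsSquare (Δ : ZMod p)) :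
    ∃ b c : ℤ, ((a : ℤ), b, c) ∈ BinaryQuadraticForm.reducedForms Δ := by
  have haZ : (0 : ℤ) < a := by exact_mod_cast ha
  -- every prime factor of `a` fails to divide `Δ`
  have hndvd : ∀ p ∈ a.primeFactors, ¬ (p : ℤ) ∣ Δ := by
    intro p hp
    by_cases hp2 : p = 2
    · subst hp2
      have h8 := h2 (Nat.dvd_of_mem_primeFactors hp)
      omega
    · exact (hsplit p hp hp2).1
  obtain ⟨b₀, hb₀⟩ := exists_sq_sub_dvd_four_mul' hΔ4 ha h2 hsplit
  obtain ⟨b, t, hbt, hb1, hb2⟩ := BinaryQuadraticForm.exists_rep_Ioc haZ b₀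
  have hdvd : (4 * a : ℤ) ∣ b ^ 2 - Δ := by
    have e : b ^ 2 - Δ = (b₀ ^ 2 - Δ) + 4 * a * (a * t ^ 2 - b₀ * t) := by rw [hbt]; ring
    rw [e]
    exact dvd_add hb₀ (Dvd.intro _ rfl)
  obtain ⟨c, hc⟩ := hdvd
  refine ⟨b, c, (BinaryQuadraticForm.mem_reducedForms_iff hΔ).2 ⟨?_, haZ, ?_, ?_⟩⟩
  · rw [BinaryQuadraticForm.discr_apply]
    linarith
  · rw [BinaryQuadraticForm.isPrimitive_iff]
    have h1 : Int.gcd (a : ℤ) b = 1 := by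
      refine BinaryQuadraticForm.int_gcd_eq_one_of_primeFactors ha (fun g hga hgb => ?_) hndvd
      have e : Δ = b ^ 2 - 4 * a * c := by linarith
      rw [e]
      exact dvd_sub (dvd_pow hgb two_ne_zero) ((hga.mul_left 4).mul_right c)
    rw [h1]
    exact Int.gcd_one_left c
  · have hac : (a : ℤ) ≤ c := by
      have h1 : 4 * (a : ℤ) * c ≥ 4 * (a : ℤ) * a := by nlinarith
      nlinarith
    refine ⟨by simp only; linarith, by simp only; exact hb2, by simp only; exact hac, ?_⟩
    simp only
    rintro (h | h | h)
    · linarith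
    · linarith
    · have : b ^ 2 ≤ 0 := by nlinarith
      nlinarith

end Literature.NumberTheory.QuadraticFields
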